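import Mathlib
import Literature.NumberTheory.EllipticCurves.PAdicLFunction
import HarnessLib

/-!
# GreenbergStevensRatioInterpolation

Topic `Literature/NumberTheory/EllipticCurves`. Named literature fact(s) relocated by the gate from `Summits/BirchSwinnertonDyer/BirchSwinnertonDyer/Theorems/TangentConeEdgeDecayGsTotalDecayOfRatioInterpolation.lean`
(accept-time relocation of `[cite]`d propositions written inline in a Summits proposal; human ruling 2026-08-15).
Sources: Delbourgo2008, GreenbergStevens1993.

* `Literature.NumberTheory.EllipticCurves.greenbergStevens_kitagawa_ratio_interpolation`

## Verdict clean-up (2026-08-17): `greenbergStevens_kitagawa_ratio_interpolation` deprecated as MIS-STATED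

The named fact `greenbergStevens_kitagawa_ratio_interpolation` is **retired from the fact census as
MIS-STATED**: no `greenbergStevens_kitagawa_ratio_interpolation_holds` can exist, because the statement is not
what [GS, Ki] (as recalled by Delbourgo) prove, and it is false in general (see the docstring).  Re-verified
against the source for this clean-up: Delbourgo 2008, §2.1, Thm. 2.2 and the definition
`𝐋_p(f, ψ, s) := ∫_{ℤ_p^×} ψ^{-1}(x) ⟨x⟩^{s-1} dμ_{f,α_p}` (book pp. 31 ff.; held copy chunk 41 of 368); §4.4, Thm. 4.11,
Def. 4.12 `𝐋^{GS}_p(𝐟, ψ, w, s) := ∫ ψ^{-1}(x) ⟨x⟩^{s-1} ε(y/x) ⟨y⟩^{w-k₀}/⟨x⟩^{w-k₀} dμ_𝐟` and the display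
`𝐋^{GS}_p(𝐟, ψ, k, s) = Per^±_{𝕀,λ_{P_{k,ε}}} × 𝐋_{p,α_p,Ω^±}(𝐟_{P_{k,ε}}, ψ, s)` (book pp. 80 ff.; held copy
chunks 98–100): the cyclotomic variable enters through `⟨x⟩^{s-1} = x^{s-1} ω^{1-s}(x)` only, so at an integer
`σ` with `(p - 1) ∤ (σ - 1)` Thm. 2.2 applies with the character `ψ = ω^{σ-1}` of conductor `p`
(twisted value, Gauss sum, no Euler factor), not with `ψ = 𝟙` as the original docstring does at every `σ`.
Human ruling 2026-08-15 (misstated facts are restated, not deleted): the CORRECTED statement — the original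
verbatim with the two hypotheses `(p - 1) ∣ (s - 1)`, `(p - 1) ∣ (j - 1)` inserted — lives under the NEW name
`Literature.NumberTheory.EllipticCurves.greenbergStevens_kitagawa_ratio_interpolation_corrected`
(`GreenbergStevensRatioInterpolationCorrectedProofs.lean`, p154625), where it is a THEOREM proved from the
named facts `greenbergStevens_kitagawa_twoVariable_interpolation` (`TwoVariablePadicLFunction.lean`; all
Teichmüller branches: `greenbergStevens_kitagawa_twoVariable_interpolation_allBranches`, p163226) and
`hida_exists_congruent_ordinary_newform` (`HidaFamilyMembers.lean`); it carries no debt of its own.  The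
correction is NOT meaning-preserving for consumers (it weakens a statement used as a hypothesis at edge
ratios `Λ(g_k, s)/Λ(g_k, j)` with `j ≢ 1 (mod p-1)`), so the old name is not reused: the `def` below is
kept byte-for-byte — the problem-side theorems `lambdaLayerOne_gsTotalDecayLeCycOrder`,
`stub_edgeDecay_of_layerOneUnit` (`Summits/…/Theorems/TangentConeEdgeDecayOfLayerOneUnit.lean`) and
`stub_edgeDecay_of_cycOrderLeRank` (`…/TangentConeEdgeDecayOfCycOrder.lean`) name it as a hypothesis
(ledger-referenced signatures; both bridges are superseded by the ratio-free, all-branches bridge of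
`…/TangentConeEdgeDecayOfCycOrderAllBranches.lean`) — and now carries `@[deprecated]` (string form: the
corrected theorem lives in a file this one does not import) with a pointer to the corrected theorem.
Those three use sites will report the deprecation until they are migrated or fenced with
`set_option linter.deprecated false in`.
-/

namespace Literature.NumberTheory.EllipticCurves

open scoped Classical
open Filter Topology

/-- **DEPRECATED 2026-08-17 — MIS-STATED (false as written); do not consume.  Corrected statement — use
instead: the theorem `Literature.NumberTheory.EllipticCurves.greenbergStevens_kitagawa_ratio_interpolation_corrected`
(file `GreenbergStevensRatioInterpolationCorrectedProofs.lean`): this statement verbatim with the hypotheses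
`(p - 1) ∣ (s - 1)`, `(p - 1) ∣ (j - 1)` inserted, proved from the named facts
`greenbergStevens_kitagawa_twoVariable_interpolation` and `hida_exists_congruent_ordinary_newform`; for the
other residue classes of `s, j` use `greenbergStevens_kitagawa_twoVariable_interpolation_allBranches`
(`TwoVariablePadicLFunction.lean`).  No `greenbergStevens_kitagawa_ratio_interpolation_holds` can exist.**

**What is wrong.** The statement below evaluates the ONE series `F` whose weight-`2` row is
`L_p(f, α; T) = ∫ (1+T)^{ℓ(x)} dμ` at `Y = γ^{σ-1} - 1` for ALL odd `σ = s, j`; that is the moment of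
`x ↦ ⟨x⟩^{σ-1} = x^{σ-1} ω^{1-σ}(x)`, which for `(p - 1) ∤ (σ - 1)` interpolates the `ω^{σ-1}`-TWISTED value
`(σ-1)! p^{σ-1} α^{-1} G(ω^{1-σ}) L(g_k, ω^{σ-1}, σ)/((2πi)^{σ-1} Ω⁺)` (Delbourgo 2008, §2.1: Thm. 2.2,
`∫ ψ^{-1}(x) x^j dμ_{f,α} = j! p^{nj} α^{-n} (1 - ψ^{-1}(p)p^j/α)(1 - ψ(p)ε(p)p^{k-2-j}/α) G(ψ^{-1})
L(f, ψ, j+1)/((2πi)^j Ω^±)` for `ψ` of conductor `p^n`, and the definition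
`𝐋_p(f, ψ, s) := ∫ ψ^{-1}(x)⟨x⟩^{s-1} dμ_{f,α}`, book pp. 31 ff., held copy chunk 41 of 368; §4.4: Thm. 4.11, Def. 4.12
`𝐋^{GS}_p(𝐟, ψ, w, s) := ∫ ψ^{-1}(x)⟨x⟩^{s-1} ε(y/x)⟨y⟩^{w-k₀}/⟨x⟩^{w-k₀} dμ_𝐟` and the display
`𝐋^{GS}_p(𝐟, ψ, k, s) = Per^± × 𝐋_{p,α_p,Ω^±}(𝐟_{P_k}, ψ, s)`, book pp. 80 ff., held copy chunks 98–100), NOT the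
untwisted `E(σ) L(g_k, σ)` claimed in the derivation below (which applies Thm. 4.11 with `ψ = 𝟙` AND the
moment `x^{σ-1}` at every `σ` — legitimate only when `⟨x⟩^{σ-1} = x^{σ-1}`, i.e. `(p - 1) ∣ (σ - 1)`; its
factor `N^{σ-1}` is also spurious, Delbourgo's `M^j` having `M = 1` here, but harmless for norms).  For
`(s, j) = (1, 3)` (admissible for every `p ≥ 5` once `k ≥ 8`) the identity mixes Teichmüller branches and
fails in general (e.g. `W = 17a1`, `p = 5`: letting `k → 2` `p`-adically in `k ≡ 2 (mod 4)`, continuity of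
the bounded series `F` in `X` and `F(0, Y) = c · L_p(f_E, α; Y)` (a unit power series: constant term
`(1 - α⁻¹)² L(E,1)/Ω⁺`, `L(E,1)/Ω⁺ = 1/4`) would force `‖ι(Λ(g_k,1)/Λ(g_k,3))‖ = 1` for `k` close to `2`,
whereas by [GS, Ki] on the branches `ω⁰` and `ω²` that norm tends to `‖∫ dμ_E‖/‖∫ x² dμ_E‖`, and
`∫ x² dμ_E ≡ ∫ ω²(x) dμ_E = α^{-1} G(χ₅) L(E, χ₅, 1)/Ω = 0 (mod 5)` by the root number
`w(E ⊗ χ₅) = χ₅(17) w(E) = -1`; numerically, PARI/GP `ellpadicL` / `mspadicL` to `15` digits give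
`v₅(∫ dμ_E) = v₅(∫⟨x⟩² dμ_E) = 0`, `v₅(∫ x² dμ_E) = 2`, `∫ ω² dμ_E = O(5¹⁵)`, the twisted symbol sum
`Σ_{a mod 5} χ₅(a)[a/5]⁺ = 0`, and (Br) checked at the levels `1, 5, 17, 85`: no weight-`2` newform other
than `f_E` is congruent to `E` modulo a prime above `5`; sketch of the tenured prove-seat, 2026-08-17 — no
Lean refutation is claimed, the objects being uncomputable in the tree).  Kept rather than deleted by the
human ruling of 2026-08-15 on misstated facts, byte-for-byte because problem-side theorems name it as a
hypothesis (see the module docstring).  The original description follows unchanged.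

**Greenberg–Stevens / Kitagawa two-variable interpolation on the Hida branch of an elliptic curve, RATIO
form** (Greenberg–Stevens 1993, Thm 5.15; Kitagawa 1994; as recalled in Delbourgo 2008, Thm 4.11, Def 4.12
and the display on p. 100: `L^GS_p(f, k, s) = Per^±_{𝕀,λ_{P_k}} × L_{p,α_p,Ω^±}(f_{P_k}, s)` at all integer
weights `k ≥ 2` of the branch, with Thm 4.11 (`ψ = 1`, `j = σ - 1 ∈ {0,…,k-2}`):
`L_{p,α,Ω^{sgn}}(f_{P_k}, σ) = (σ-1)! N^{σ-1} (1 - p^{σ-1}/α_k) L(f_{P_k}, σ)/((2πi)^{σ-1} Ω^{sgn}_{f_{P_k}})`,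
`sgn = (-1)^{σ-1}`, `f_{P_k}` the ordinary `p`-stabilisation of the newform `g_k`, so
`L(f_{P_k}, σ) = (1 - p^{k-1-σ}/α_k) L(g_k, σ)`).
Special case stated here, in the tree's vocabulary (no two-variable object, no periods): let `W` be a globally
minimal elliptic curve over `ℚ` of conductor `N`, `p ≥ 5` a good ordinary prime with `a_p(E)² ≢ 1 (mod p)` and
surjective mod-`p` representation, such that (Br) `f_E` is the only ordinary weight-`2` newform of level
dividing `N p` congruent to `E` away from `N p` (then the branch `𝕀` of the ordinary `Λ`-adic Hecke algebra
through `f_E` is `Λ^wt = ℤ_p⟦X⟧` itself: Hida's control theorem and freeness for `p ≥ 5`, the fibre at weight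
`2` being one reduced point; Delbourgo p. 96, Emerton–Pollack–Weston Thm 2.2.2), and let `f` be the newform
of `W`. Then there is a bounded double series `F(X, Y) = Σ F_ij X^i Y^j ∈ ℤ_p⟦X,Y⟧ ⊗ ℚ_p` — the two-variable
`p`-adic `L`-function in the coordinates `X = γ^{k-2} - 1` (weight), `Y = γ^{s-1} - 1` (cyclotomic),
`γ = 1 + p = cyclotomicGenerator p` — with `F(0, Y) = c · L_p(f, α; Y)`, `c = Per⁺_{P_2} · (Ω-ratio) ≠ 0`
(the tree's `padicLFunction f (unitRoot W p)`, Mazur–Tate–Teitelbaum), such that for every classical weight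
`k > 2`, `k ≡ 2 (mod p-1)`, the weight-`k` member `g_k ∈ S_k(Γ₀(N))` of the branch (a `p`-ordinary newform
with a `p`-adic embedding `ι` of its coefficient field under which it is congruent to `E`; Hida 1986) has,
for all odd `s, j` with `2s < k`, `3 ≤ j`, `2j < k`, edge critical-value ratio
`R = Λ(g_k,s)/Λ(g_k,j) ∈ K_{g_k}` (`Λ(g,σ) = ∫₀^∞ t^{σ-1} g(it) dt = Γ(σ)(2π)^{-σ} L(g,σ)`; same sign, so
`Per⁺_{P_k}` and `Ω⁺_{g_k}` CANCEL: `ι(R) = ± N^{j-s} E(j)/E(s) · F(x_k,y_s)/F(x_k,y_j)` with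
`E(σ) = (1 - p^{σ-1}/α_k)(1 - p^{k-1-σ}/α_k)`, all of `p`-adic norm one in this range because
`a_p(g_k) ≡ a_p(E) ≢ 1 (mod p)`, and `L(g_k, j) ≠ 0` for `j < k/2`) satisfying the NORM identity
`‖ι R‖ · ‖F(x_k, y_j)‖ = ‖F(x_k, y_s)‖`.
-- TODO(general form): the measure `μ_f` on `ℤ_{p,M}^× × ℤ_p^×` with values in `𝕀` and its full interpolation
-- formula at all arithmetic points `P_{k,ε}` and all finite-order `ψ` (Delbourgo Thm 4.11), of which this is the
-- `ψ = ε = 1`, same-sign-ratio, `𝕀 = Λ^wt` case.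
[cite: GreenbergStevens1993, Thm 5.15 — misapplied off the trivial Teichmüller branch (ψ = 𝟙 at every σ), see the deprecation note; corrected as greenbergStevens_kitagawa_ratio_interpolation_corrected]
[cite: Delbourgo2008, §4.4 Thm 4.11, Def 4.12 and the display following it (pp. 80 ff.; held copy chunks 98–100), with §2.1 Thm 2.2 — idem]
[file NumberTheory/EllipticCurves/GreenbergStevensRatioInterpolation] -/
@[deprecated "misstated, false as written: at Y = γ^(σ-1) - 1 with (p-1) ∤ (σ-1) the series F gives the \
  ω^(σ-1)-TWISTED L-value of g_k (Delbourgo 2008, Def. 4.12 with §2.1 Thm. 2.2), not E(σ)·L(g_k, σ); \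
  corrected statement (hypotheses (p-1) ∣ (s-1), (p-1) ∣ (j-1) inserted): the theorem \
  Literature.NumberTheory.EllipticCurves.greenbergStevens_kitagawa_ratio_interpolation_corrected \
  (GreenbergStevensRatioInterpolationCorrectedProofs.lean), proved from the named facts \
  greenbergStevens_kitagawa_twoVariable_interpolation and hida_exists_congruent_ordinary_newform; \
  all Teichmüller branches: greenbergStevens_kitagawa_twoVariable_interpolation_allBranches \
  (TwoVariablePadicLFunction.lean)" (since := "2026-08-17")]
def greenbergStevens_kitagawa_ratio_interpolation : Prop :=
  ∀ (W : WeierstrassCurve ℚ) [W.IsElliptic] [W.IsGloballyMinimal] (_ : NeZero (W.conductorNorm ℤ)) (p : ℕ) [Fact p.Prime], 5 ≤ p → W.HasGoodReductionAtPrime p → ¬ (p : ℤ) ∣ W.frobeniusTrace p → ¬ (p : ℤ) ∣ (W.frobeniusTrace p) ^ 2 - 1 → W.HasSurjectiveModNGaloisRep p → (∀ (M : ℕ) (_ : NeZero M) (g : CuspForm (CongruenceSubgroup.Gamma0 M) 2) (ι : Literature.NumberTheory.EllipticCurves.ModularForms.coeffField g →+* PadicAlgCl p), M ∣ W.conductorNorm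 ℤ * p → Literature.NumberTheory.EllipticCurves.ModularForms.IsNewform0 g → ‖ι ⟨(UpperHalfPlane.qExpansion 1 ⇑g).coeff p, Literature.NumberTheory.EllipticCurves.ModularForms.coeff_mem_coeffField g p⟩‖ = 1 → (∀ ℓ : ℕ, ℓ.Prime → ¬ ℓ ∣ W.conductorNorm ℤ * p → ‖ι ⟨(UpperHalfPlane.qExpansion 1 ⇑g).coeff ℓ, Literature.NumberTheory.EllipticCurves.ModularForms.coeff_mem_coeffField g ℓ⟩ - ((W.frobeniusTrace ℓ : ℤ) : PadicAlgCl p)‖ < 1) → M = W.conductorNorm ℤ ∧ ∀ n : ℕ, (UpperHalfPlane.qExpansion 1 ⇑g).coeff n = ((W.LFunction n : ℤ) : ℂ)) → ∀ (f : CuspForm (CongruenceSubgroup.Gamma0 (W.conductorNorm ℤ)) 2), Literature.NumberTheory.EllipticCurves.ModularForms.IsNewformOf W f → ∃ (F : ℕ → ℕ → ℚ_[p]) (M : ℝ) (c : ℚ_[p]), c ≠ 0 ∧ (∀ i j : ℕ, ‖F i j‖ ≤ M) ∧ (∀ j : ℕ, F 0 j = c * Literature.NumberTheory.EllipticCurves.padicLCoeff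 f (Literature.NumberTheory.EllipticCurves.unitRoot W p : ℚ_[p]) j) ∧ ∀ (k : ℤ), 2 < k → ((p : ℤ) - 1) ∣ (k - 2) → ∃ (g : CuspForm (CongruenceSubgroup.Gamma0 (W.conductorNorm ℤ)) k) (ι : Literature.NumberTheory.EllipticCurves.ModularForms.coeffField g →+* PadicAlgCl p), Literature.NumberTheory.EllipticCurves.ModularForms.IsNewform0 g ∧ ‖ι ⟨(UpperHalfPlane.qExpansion 1 ⇑g).coeff p, Literature.NumberTheory.EllipticCurves.ModularForms.coeff_mem_coeffField g p⟩‖ = 1 ∧ (∀ ℓ : ℕ, ℓ.Prime → ¬ ℓ ∣ W.conductorNorm ℤ * p → ‖ι ⟨(UpperHalfPlane.qExpansion 1 ⇑g).coeff ℓ, Literature.NumberTheory.EllipticCurves.ModularForms.coeff_mem_coeffField g ℓ⟩ - ((W.frobeniusTrace ℓ : ℤ) : PadicAlgCl p)‖ < 1) ∧ ∀ (s j : ℕ), Odd s → Odd j → 2 * (s : ℤ) < k → 3 ≤ j → 2 * (j : ℤ) < k → ∃ hR : (∫ t in Set.Ioi (0 : ℝ), ((t : ℂ) ^ (s - 1))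 * g (UpperHalfPlane.ofComplex ((t : ℂ) * Complex.I))) / (∫ t in Set.Ioi (0 : ℝ), ((t : ℂ) ^ (j - 1)) * g (UpperHalfPlane.ofComplex ((t : ℂ) * Complex.I))) ∈ Literature.NumberTheory.EllipticCurves.ModularForms.coeffField g, ‖ι ⟨_, hR⟩‖ * ‖∑' n : ℕ × ℕ, F n.1 n.2 * (((Literature.NumberTheory.EllipticCurves.cyclotomicGenerator p : ℕ) : ℚ_[p]) ^ (k - 2).toNat - 1) ^ n.1 * (((Literature.NumberTheory.EllipticCurves.cyclotomicGenerator p : ℕ) : ℚ_[p]) ^ (j - 1) - 1) ^ n.2‖ = ‖∑' n : ℕ × ℕ, F n.1 n.2 * (((Literature.NumberTheory.EllipticCurves.cyclotomicGenerator p : ℕ) : ℚ_[p]) ^ (k - 2).toNat - 1) ^ n.1 * (((Literature.NumberTheory.EllipticCurves.cyclotomicGenerator p : ℕ) : ℚ_[p]) ^ (s - 1) - 1) ^ n.2‖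

end Literature.NumberTheory.EllipticCurves
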